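import Summits.QuantumFields.YangMills.Theorems.BalabanUVNodesN15TwoSpacingGluingCurvedKnitCovariantLandauNodeGradDiffRow
import Summits.QuantumFields.YangMills.Theorems.BalabanUVNodesN15TwoSpacingGluingCurvedKnitCovariantLandauGlobalRowsFromFlat
import HarnessLib

/-!
# N15 = NE2 — dag-n15-a g33, PROGRAMME ♭ «FLAT ROWS», (♭-6): n15-c∕221's AND n15-c∕223's INLINE REDUCTIONS NAMED — King's three flat kernel rows (n15-c∕220) and the Combes–Thomas `S⁻¹`
# row (n15-c∕222b) feed n15-c∕219 v1.1's mass-window display; composed with (♭-1): 207b's THREE THRESHOLDED GLOBAL LANDAU ROWS from the ONE covariant gradient-difference row per grid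
# + the two-grid defect row — the socket all three layers of the (P-R) one-propagator literal plug into
# (dag-n15-a g33, (♭-6); node N15 = NE2; `--supports stmt-QuantumFields-27366 --as helper`, count-neutral; four theorems; imports n15-c∕223 (→ 221, 222b, 220, 219), (♭-1))

WHY.  n15-c∕221 `ne2PlusOperator_sfqr_of_sopRow` and n15-c∕223 `ne2PlusOperator_sfqr_of_gradDiffRow` (p746784, «(P-S) MILESTONE»: ALL FOUR FLAT ROWS PROVED) close the OPERATOR layer
of the (P-R) family from, per grid, the ONE covariant gradient-difference row `D_TG′(T) − ∂G′(1)` ([B9] Thm 3.4), the two-grid η-defect row of `N_V^R` and entries 1–3 — reducing INLINE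
to n15-c∕219 v1.1 (`refine ne2PlusOperator_sfqr_of_flatRows_mass … ⟨…⟩ hD`, resp. `… _of_sopRow …`).  As with (♭-1) for 219, the site and unit layers of the (P-R) one-propagator literal
((♭-3)∕(♭-5)) can read the SAME display only if these reductions are NAMED lemmas.  THIS FILE states them with 221's ∕ 223's proof texts minus their last lines, and composes with (♭-1).

WHAT.  ★★ `flatRowsMass_of_sopRow (hS) : (219 v1.1's hF)` (King's masses `a_K(1,L,kk)`, `a_K(1,L,r+kk)` as the window witnesses; n15-c∕220 `flatKernelRows_king`); ★★ `sopRow_of_gradDiffRow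
(hP) : (221's hS)` (n15-c∕222b `flatSopRow_ct_uniform` on `[1∕2, 1]`, `aK_ge`); ★★ `landauRows_small_of_sopRow (hS) (hD)`; ★★★ `landauRows_small_of_gradDiffRow (hP) (hD) : (207b's hG)`.
Hypothesis texts = 221's ∕ 223's LITERALLY; conclusions = 219 v1.1's `hF` ∕ 221's `hS` ∕ 207b's `hG` LITERALLY.  Consistency (not restated): `ne2PlusOperator_sfqr_of_gradDiffRow … E hE hP hD`
= `ne2PlusOperator_sfqr_of_global_small … E hE (landauRows_small_of_gradDiffRow … hP hD)` up to proof irrelevance.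

HONEST FRAMING ∕ LIMITS.  Bookkeeping on dag-n15-c's MODEL carriers (doubled-torus cover `2L^{m+1}`, global small-field gauge, one averaging level, unit weights, site transporters); the
flat rows are King's `A = 0` MODEL theorems (dag-n15-e's rung) and the T⁴ cell's Combes–Thomas theorem read through exact dictionaries (n15-c∕220∕222b — theirs, consumed BY NAME); the
gradient-difference rows and the two-grid defect row are HYPOTHESES; NOT [Balaban1985BackgroundPropagators] Thms 3.1–3.4 ∕ (3.49) as printed and no estimate of Bałaban's; NE2⁺ NOT
PRINTED; N15 stays DISCHARGED OF RECORD 8∕27 AS CONSUMED (U-blind v7 pin, p687738) — nothing re-claimed, no count moved; K3⁸ OPEN; finite 𝕋⁴ per index — NOT ℝ⁴ ∕ OS ∕ mass gap ∕ Clay.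
No `sorry`, `instance`, `notation`; standard axioms.  Restate-immune (no Theses import).
-/

noncomputable section

open scoped BigOperators Matrix

namespace Summit.QuantumFields.YangMills.BalabanUVNodes.N15.Gluing

open Literature.MathematicalPhysics.QuantumFieldTheory.Balaban1983to89
open Literature.MathematicalPhysics.QuantumFieldTheory.Balaban1983to89.B11SectG (BlockNorm HasMaj)
open Literature.MathematicalPhysics.QuantumFieldTheory.Balaban1983to89.T4EtaRateDefect (idef)
open Literature.MathematicalPhysics.QuantumFieldTheory.Balaban1983to89.T4EtaRateCoeffDefect (pull)
open Literature.MathematicalPhysics.QuantumFieldTheory.Balaban1983to89.B6UnitTorusCarrier (unitTorusGeo unitTorusGeo_dist_nonneg)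
open Literature.MathematicalPhysics.QuantumFieldTheory.Balaban1983to89.B5Prop11Plancherel (Tor fine)
open Literature.MathematicalPhysics.QuantumFieldTheory.Balaban1983to89.T4EtaRate (NE2PlusOperator rateFactor)
open Literature.MathematicalPhysics.QuantumFieldTheory.King1986 (aK aK_pos aK_le aK_ge)
open Literature.MathematicalPhysics.QuantumFieldTheory.King1986.Torus (blockOf tdistT)
open Literature.Barriers.QuantumFields (traceForm)
open Summit.QuantumFields.YangMills.BalabanUVNodes.N15.BackgroundLayer (gavgM)
open Summit.QuantumFields.YangMills.BalabanUVNodes.N15.VectorPiece (kingPrV blkFine_comp_kingPrV)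
open Summit.QuantumFields.YangMills.BalabanUVNodes.N15.MatrixSpecies (liftBlk liftMap basisConst basisConst_nonneg)
open Summit.QuantumFields.YangMills.BalabanUVNodes.N15.OperatorReadout (opGeo)
open Summit.QuantumFields.YangMills.BalabanUVNodes.N15.CovLandau (cgrad csavg cGreen cSop flatKernelRows_king flatSopRow_ct_uniform)
open Summit.QuantumFields.YangMills.BalabanUVNodes.N15.CurvedSpecies (exp_smul_unitary_of_conjTranspose)
open Summit.QuantumFields.YangMills.BalabanUVNodes.N15.SiteLayerSf (norm_gavgM_le_of_norm_le)

variable {d : ℕ} {L : ℕ} [NeZero L]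

section Node

open scoped Matrix.Norms.L2Operator

variable (d) (mm ι : Type) [Fintype mm] [DecidableEq mm] [Nonempty mm] [Fintype ι] [DecidableEq ι] (e : Matrix mm mm ℂ ≃L[ℝ] (ι → ℝ))

omit [Nonempty mm] in
/-- ★★ **n15-c∕219 v1.1's MASS-WINDOW FLAT-ROW DISPLAY `hF` FROM n15-c∕221's DISPLAY `hS`** (the `S⁻¹` rows + the covariant gradient-difference rows at King's masses): the three flat
kernel rows `G′(1)`, `∂G′(1)`, `G′(1)∂ᵀ` are n15-c∕220 `flatKernelRows_king` (dag-n15-e's King-model rung) on both grids at King's masses `a_K(1,L,kk)`, `a_K(1,L,r+kk)` — n15-c∕221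
`ne2PlusOperator_sfqr_of_sopRow`'s proof text minus its last line, NAMED so that the site and unit layers consume the same display.  MODEL (King `A = 0` rung); the `S⁻¹` and
gradient-difference rows stay HYPOTHESES here. [cite: Balaban1984PropagatorsII, Props. 2.2–2.3 pp.228–231 (shape); Balaban1983RegularityDecay, Theorem (1.10) p.573; King1986, Thm 3.3 p.656, Prop. 3.9 (3.73) p.665] -/
theorem flatRowsMass_of_sopRow (hL : Odd L ∧ 1 < L) (hL7 : 7 ≤ L) {c35 : ℝ} (hc35 : 0 < c35)
    (hS : ∃ δ₂ CS P0 aP : ℝ, 0 < δ₂ ∧ 0 ≤ CS ∧ 0 ≤ P0 ∧ 0 < aP ∧ ∀ i : SfIdx d L,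
        HasMaj (BlockNorm.ofBlocks (unitTorusGeo L i.kk (cvM d L i.m i.kk hL)) (liftBlk (fun y : Tor (cvM d L i.m i.kk hL) => y) ι)) (BlockNorm.ofBlocks (unitTorusGeo L i.kk (cvM d L i.m i.kk hL)) (liftBlk (fun y : Tor (cvM d L i.m i.kk hL) => y) ι)) (Matrix.mulVecLin (cSop (cvM d L i.m i.kk hL) (L ^ i.kk) (fun (_ : Fin (d + 1)) (_ : Tor (fine (L ^ i.kk) (cvM d L i.m i.kk hL))) => (1 : Matrix ι ι ℝ)) (aK 1 (L : ℝ) i.kk * ((L ^ i.kk : ℕ) : ℝ) ^ (d + 1)))⁻¹) (fun y y' => CS * ((L ^ i.kk : ℕ) : ℝ) ^ (d + 1) * Real.exp (-(δ₂ * (unitTorusGeo L i.kk (cvM d L i.m i.kk hL)).dist y y'))) ∧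
        HasMaj (BlockNorm.ofBlocks (unitTorusGeo L i.kk (cvM d L i.m i.kk hL)) (liftBlk (fun y : Tor (cvM d L i.m i.kk hL) => y) ι)) (BlockNorm.ofBlocks (unitTorusGeo L i.kk (cvM d L i.m i.kk hL)) (liftBlk (fun y : Tor (cvM d L i.m i.kk hL) => y) ι)) (Matrix.mulVecLin (cSop (cvM d L i.m i.kk hL) (L ^ i.r * L ^ i.kk) (fun (_ : Fin (d + 1)) (_ : Tor (fine (L ^ i.r * L ^ i.kk) (cvM d L i.m i.kk hL))) => (1 : Matrix ι ι ℝ)) (aK 1 (L : ℝ) (i.r + i.kk) * ((L ^ i.r * L ^ i.kk : ℕ) : ℝ) ^ (d + 1)))⁻¹) (fun y y' => CS * ((L ^ i.r * L ^ i.kk : ℕ) : ℝ) ^ (d + 1) * Real.exp (-(δ₂ * (unitTorusGeo L i.kk (cvM d L i.m i.kk hL)).dist y y'))) ∧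
        (∀ α₀ : ℝ, 0 < α₀ → (L : ℝ) ^ i.m * α₀ ≤ aP → ∀ A' : Fin (d + 1) → CvX' d L i.m i.kk i.r hL → Matrix mm mm ℂ, (sfInstance d mm ι hL i).Bf.Reg335 c35 α₀ A' →
          HasMaj (BlockNorm.ofBlocks (unitTorusGeo L i.kk (cvM d L i.m i.kk hL)) (liftBlk (blockOf (L ^ i.kk) (cvM d L i.m i.kk hL)) ι)) (BlockNorm.ofBlocks (unitTorusGeo L i.kk (cvM d L i.m i.kk hL)) (liftBlk (fun b : Tor (fine (L ^ i.kk) (cvM d L i.m i.kk hL)) × Fin (d + 1) => blockOf (L ^ i.kk) (cvM d L i.m i.kk hL) b.1) ι)) (Matrix.mulVecLin (cgrad (cvM d L i.m i.kk hL) (L ^ i.kk) (cvT₀ e (fun μ x => NormedSpace.exp (((((L ^ i.kk : ℕ) : ℝ))⁻¹) • gavgM (Matrix mm mm ℂ) (Fin (d + 1)) (kingPrV L i.kk i.r (cvM d L i.m i.kk hL)) A' μ x))) * cGreen (cvM d L i.m i.kk hL) (L ^ i.kk) (cvT₀ e (fun μ x => NormedSpace.exp (((((L ^ i.kk : ℕ)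 : ℝ))⁻¹) • gavgM (Matrix mm mm ℂ) (Fin (d + 1)) (kingPrV L i.kk i.r (cvM d L i.m i.kk hL)) A' μ x))) (aK 1 (L : ℝ) i.kk * ((L ^ i.kk : ℕ) : ℝ) ^ (d + 1)) - cgrad (cvM d L i.m i.kk hL) (L ^ i.kk) (fun (_ : Fin (d + 1)) (_ : Tor (fine (L ^ i.kk) (cvM d L i.m i.kk hL))) => (1 : Matrix ι ι ℝ)) * cGreen (cvM d L i.m i.kk hL) (L ^ i.kk) (fun (_ : Fin (d + 1)) (_ : Tor (fine (L ^ i.kk) (cvM d L i.m i.kk hL))) => (1 : Matrix ι ι ℝ)) (aK 1 (L : ℝ) i.kk * ((L ^ i.kk : ℕ) : ℝ) ^ (d + 1)))) (fun y y' => P0 * (c35 * (L : ℝ) ^ i.m * α₀) * Real.exp (-(δ₂ * (unitTorusGeo L i.kk (cvM d L i.m i.kk hL)).dist y y'))) ∧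
          HasMaj (BlockNorm.ofBlocks (unitTorusGeo L i.kk (cvM d L i.m i.kk hL)) (liftBlk (blockOf (L ^ i.r * L ^ i.kk) (cvM d L i.m i.kk hL)) ι)) (BlockNorm.ofBlocks (unitTorusGeo L i.kk (cvM d L i.m i.kk hL)) (liftBlk (fun b : Tor (fine (L ^ i.r * L ^ i.kk) (cvM d L i.m i.kk hL)) × Fin (d + 1) => blockOf (L ^ i.r * L ^ i.kk) (cvM d L i.m i.kk hL) b.1) ι)) (Matrix.mulVecLin (cgrad (cvM d L i.m i.kk hL) (L ^ i.r * L ^ i.kk) (cvT₀ e (fun μ x' => NormedSpace.exp (((((L ^ i.r * L ^ i.kk : ℕ) : ℝ))⁻¹) • A' μ x'))) * cGreen (cvM d L i.m i.kk hL) (L ^ i.r * L ^ i.kk) (cvT₀ e (fun μ x' => NormedSpace.exp (((((L ^ i.r * L ^ i.kk : ℕ) : ℝ))⁻¹) • A' μ x'))) (aK 1 (L : ℝ) (i.r + i.kk) * ((L ^ i.r * L ^ i.kk : ℕ) : ℝ) ^ (d + 1)) - cgrad (cvM d L i.m i.kk hL) (L ^ i.r * L ^ i.kk) (fun (_ : Fin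 (d + 1)) (_ : Tor (fine (L ^ i.r * L ^ i.kk) (cvM d L i.m i.kk hL))) => (1 : Matrix ι ι ℝ)) * cGreen (cvM d L i.m i.kk hL) (L ^ i.r * L ^ i.kk) (fun (_ : Fin (d + 1)) (_ : Tor (fine (L ^ i.r * L ^ i.kk) (cvM d L i.m i.kk hL))) => (1 : Matrix ι ι ℝ)) (aK 1 (L : ℝ) (i.r + i.kk) * ((L ^ i.r * L ^ i.kk : ℕ) : ℝ) ^ (d + 1)))) (fun y y' => P0 * (c35 * (L : ℝ) ^ i.m * α₀) * Real.exp (-(δ₂ * (unitTorusGeo L i.kk (cvM d L i.m i.kk hL)).dist y y'))))) :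
    ∃ δF CG CA CD CS P0 aP : ℝ, 0 < δF ∧ 0 ≤ CG ∧ 0 ≤ CA ∧ 0 ≤ CD ∧ 0 ≤ CS ∧ 0 ≤ P0 ∧ 0 < aP ∧ ∀ i : SfIdx d L, ∃ awC awF : ℝ, 0 < awC ∧ awC ≤ 1 ∧ 0 < awF ∧ awF ≤ 1 ∧
        (HasMaj (BlockNorm.ofBlocks (unitTorusGeo L i.kk (cvM d L i.m i.kk hL)) (liftBlk (blockOf (L ^ i.kk) (cvM d L i.m i.kk hL)) ι)) (BlockNorm.ofBlocks (unitTorusGeo L i.kk (cvM d L i.m i.kk hL)) (liftBlk (blockOf (L ^ i.kk) (cvM d L i.m i.kk hL)) ι)) (Matrix.mulVecLin (cGreen (cvM d L i.m i.kk hL) (L ^ i.kk) (fun (_ : Fin (d + 1)) (_ : Tor (fine (L ^ i.kk) (cvM d L i.m i.kk hL))) => (1 : Matrix ι ι ℝ)) (awC * ((L ^ i.kk : ℕ) : ℝ) ^ (d + 1)))) (fun y y' => CG * Real.exp (-(δF * (unitTorusGeo L i.kk (cvM d L i.m i.kk hL)).dist y y'))) ∧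
          HasMaj (BlockNorm.ofBlocks (unitTorusGeo L i.kk (cvM d L i.m i.kk hL)) (liftBlk (fun b : Tor (fine (L ^ i.kk) (cvM d L i.m i.kk hL)) × Fin (d + 1) => blockOf (L ^ i.kk) (cvM d L i.m i.kk hL) b.1) ι)) (BlockNorm.ofBlocks (unitTorusGeo L i.kk (cvM d L i.m i.kk hL)) (liftBlk (blockOf (L ^ i.kk) (cvM d L i.m i.kk hL)) ι)) (Matrix.mulVecLin (cGreen (cvM d L i.m i.kk hL) (L ^ i.kk) (fun (_ : Fin (d + 1)) (_ : Tor (fine (L ^ i.kk) (cvM d L i.m i.kk hL))) => (1 : Matrix ι ι ℝ)) (awC * ((L ^ i.kk : ℕ) : ℝ) ^ (d + 1)) * (cgrad (cvM d L i.m i.kk hL) (L ^ i.kk) (fun (_ : Fin (d + 1)) (_ : Tor (fine (L ^ i.kk) (cvM d L i.m i.kk hL))) => (1 : Matrix ι ι ℝ)))ᵀ)) (fun y y' => CA * Real.exp (-(δF * (unitTorusGeo L i.kk (cvM d L i.m i.kk hL)).dist y y'))) ∧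
          HasMaj (BlockNorm.ofBlocks (unitTorusGeo L i.kk (cvM d L i.m i.kk hL)) (liftBlk (blockOf (L ^ i.kk) (cvM d L i.m i.kk hL)) ι)) (BlockNorm.ofBlocks (unitTorusGeo L i.kk (cvM d L i.m i.kk hL)) (liftBlk (fun b : Tor (fine (L ^ i.kk) (cvM d L i.m i.kk hL)) × Fin (d + 1) => blockOf (L ^ i.kk) (cvM d L i.m i.kk hL) b.1) ι)) (Matrix.mulVecLin (cgrad (cvM d L i.m i.kk hL) (L ^ i.kk) (fun (_ : Fin (d + 1)) (_ : Tor (fine (L ^ i.kk) (cvM d L i.m i.kk hL))) => (1 : Matrix ι ι ℝ)) * cGreen (cvM d L i.m i.kk hL) (L ^ i.kk) (fun (_ : Fin (d + 1)) (_ : Tor (fine (L ^ i.kk) (cvM d L i.m i.kk hL))) => (1 : Matrix ι ι ℝ)) (awC * ((L ^ i.kk : ℕ) : ℝ) ^ (d + 1)))) (fun y y' => CD * Real.exp (-(δF * (unitTorusGeo L i.kk (cvM d L i.m i.kk hL)).dist y y'))) ∧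
          HasMaj (BlockNorm.ofBlocks (unitTorusGeo L i.kk (cvM d L i.m i.kk hL)) (liftBlk (fun y : Tor (cvM d L i.m i.kk hL) => y) ι)) (BlockNorm.ofBlocks (unitTorusGeo L i.kk (cvM d L i.m i.kk hL)) (liftBlk (fun y : Tor (cvM d L i.m i.kk hL) => y) ι)) (Matrix.mulVecLin (cSop (cvM d L i.m i.kk hL) (L ^ i.kk) (fun (_ : Fin (d + 1)) (_ : Tor (fine (L ^ i.kk) (cvM d L i.m i.kk hL))) => (1 : Matrix ι ι ℝ)) (awC * ((L ^ i.kk : ℕ) : ℝ) ^ (d + 1)))⁻¹) (fun y y' => CS * ((L ^ i.kk : ℕ) : ℝ) ^ (d + 1) * Real.exp (-(δF * (unitTorusGeo L i.kk (cvM d L i.m i.kk hL)).dist y y')))) ∧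
        (HasMaj (BlockNorm.ofBlocks (unitTorusGeo L i.kk (cvM d L i.m i.kk hL)) (liftBlk (blockOf (L ^ i.r * L ^ i.kk) (cvM d L i.m i.kk hL)) ι)) (BlockNorm.ofBlocks (unitTorusGeo L i.kk (cvM d L i.m i.kk hL)) (liftBlk (blockOf (L ^ i.r * L ^ i.kk) (cvM d L i.m i.kk hL)) ι)) (Matrix.mulVecLin (cGreen (cvM d L i.m i.kk hL) (L ^ i.r * L ^ i.kk) (fun (_ : Fin (d + 1)) (_ : Tor (fine (L ^ i.r * L ^ i.kk) (cvM d L i.m i.kk hL))) => (1 : Matrix ι ι ℝ)) (awF * ((L ^ i.r * L ^ i.kk : ℕ) : ℝ) ^ (d + 1)))) (fun y y' => CG * Real.exp (-(δF * (unitTorusGeo L i.kk (cvM d L i.m i.kk hL)).dist y y'))) ∧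
          HasMaj (BlockNorm.ofBlocks (unitTorusGeo L i.kk (cvM d L i.m i.kk hL)) (liftBlk (fun b : Tor (fine (L ^ i.r * L ^ i.kk) (cvM d L i.m i.kk hL)) × Fin (d + 1) => blockOf (L ^ i.r * L ^ i.kk) (cvM d L i.m i.kk hL) b.1) ι)) (BlockNorm.ofBlocks (unitTorusGeo L i.kk (cvM d L i.m i.kk hL)) (liftBlk (blockOf (L ^ i.r * L ^ i.kk) (cvM d L i.m i.kk hL)) ι)) (Matrix.mulVecLin (cGreen (cvM d L i.m i.kk hL) (L ^ i.r * L ^ i.kk) (fun (_ : Fin (d + 1)) (_ : Tor (fine (L ^ i.r * L ^ i.kk) (cvM d L i.m i.kk hL))) => (1 : Matrix ι ι ℝ)) (awF * ((L ^ i.r * L ^ i.kk : ℕ) : ℝ) ^ (d + 1)) * (cgrad (cvM d L i.m i.kk hL) (L ^ i.r * L ^ i.kk) (fun (_ : Fin (d + 1)) (_ : Tor (fine (L ^ i.r * L ^ i.kk) (cvM d L i.m i.kk hL))) => (1 : Matrix ι ι ℝ)))ᵀ)) (fun y y' => CA * Real.exp (-(δF * (unitTorusGeo L i.kk (cvM d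 L i.m i.kk hL)).dist y y'))) ∧
          HasMaj (BlockNorm.ofBlocks (unitTorusGeo L i.kk (cvM d L i.m i.kk hL)) (liftBlk (blockOf (L ^ i.r * L ^ i.kk) (cvM d L i.m i.kk hL)) ι)) (BlockNorm.ofBlocks (unitTorusGeo L i.kk (cvM d L i.m i.kk hL)) (liftBlk (fun b : Tor (fine (L ^ i.r * L ^ i.kk) (cvM d L i.m i.kk hL)) × Fin (d + 1) => blockOf (L ^ i.r * L ^ i.kk) (cvM d L i.m i.kk hL) b.1) ι)) (Matrix.mulVecLin (cgrad (cvM d L i.m i.kk hL) (L ^ i.r * L ^ i.kk) (fun (_ : Fin (d + 1)) (_ : Tor (fine (L ^ i.r * L ^ i.kk) (cvM d L i.m i.kk hL))) => (1 : Matrix ι ι ℝ)) * cGreen (cvM d L i.m i.kk hL) (L ^ i.r * L ^ i.kk) (fun (_ : Fin (d + 1)) (_ : Tor (fine (L ^ i.r * L ^ i.kk) (cvM d L i.m i.kk hL))) => (1 : Matrix ι ι ℝ)) (awF * ((L ^ i.r * L ^ i.kk : ℕ) : ℝ) ^ (d + 1)))) (fun y y' => CD * Real.exp (-(δF * (unitTorusGeo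 L i.kk (cvM d L i.m i.kk hL)).dist y y'))) ∧
          HasMaj (BlockNorm.ofBlocks (unitTorusGeo L i.kk (cvM d L i.m i.kk hL)) (liftBlk (fun y : Tor (cvM d L i.m i.kk hL) => y) ι)) (BlockNorm.ofBlocks (unitTorusGeo L i.kk (cvM d L i.m i.kk hL)) (liftBlk (fun y : Tor (cvM d L i.m i.kk hL) => y) ι)) (Matrix.mulVecLin (cSop (cvM d L i.m i.kk hL) (L ^ i.r * L ^ i.kk) (fun (_ : Fin (d + 1)) (_ : Tor (fine (L ^ i.r * L ^ i.kk) (cvM d L i.m i.kk hL))) => (1 : Matrix ι ι ℝ)) (awF * ((L ^ i.r * L ^ i.kk : ℕ) : ℝ) ^ (d + 1)))⁻¹) (fun y y' => CS * ((L ^ i.r * L ^ i.kk : ℕ) : ℝ) ^ (d + 1) * Real.exp (-(δF * (unitTorusGeo L i.kk (cvM d L i.m i.kk hL)).dist y y')))) ∧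
        (∀ α₀ : ℝ, 0 < α₀ → (L : ℝ) ^ i.m * α₀ ≤ aP → ∀ A' : Fin (d + 1) → CvX' d L i.m i.kk i.r hL → Matrix mm mm ℂ, (sfInstance d mm ι hL i).Bf.Reg335 c35 α₀ A' →
          HasMaj (BlockNorm.ofBlocks (unitTorusGeo L i.kk (cvM d L i.m i.kk hL)) (liftBlk (blockOf (L ^ i.kk) (cvM d L i.m i.kk hL)) ι)) (BlockNorm.ofBlocks (unitTorusGeo L i.kk (cvM d L i.m i.kk hL)) (liftBlk (fun b : Tor (fine (L ^ i.kk) (cvM d L i.m i.kk hL)) × Fin (d + 1) => blockOf (L ^ i.kk) (cvM d L i.m i.kk hL) b.1) ι)) (Matrix.mulVecLin (cgrad (cvM d L i.m i.kk hL) (L ^ i.kk) (cvT₀ e (fun μ x => NormedSpace.exp (((((L ^ i.kk : ℕ) : ℝ))⁻¹) • gavgM (Matrix mm mm ℂ) (Fin (d + 1)) (kingPrV L i.kk i.r (cvM d L i.m i.kk hL)) A' μ x))) * cGreen (cvM d L i.m i.kk hL) (L ^ i.kk) (cvT₀ e (fun μ x => NormedSpace.exp (((((L ^ i.kk : ℕ)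 : ℝ))⁻¹) • gavgM (Matrix mm mm ℂ) (Fin (d + 1)) (kingPrV L i.kk i.r (cvM d L i.m i.kk hL)) A' μ x))) (awC * ((L ^ i.kk : ℕ) : ℝ) ^ (d + 1)) - cgrad (cvM d L i.m i.kk hL) (L ^ i.kk) (fun (_ : Fin (d + 1)) (_ : Tor (fine (L ^ i.kk) (cvM d L i.m i.kk hL))) => (1 : Matrix ι ι ℝ)) * cGreen (cvM d L i.m i.kk hL) (L ^ i.kk) (fun (_ : Fin (d + 1)) (_ : Tor (fine (L ^ i.kk) (cvM d L i.m i.kk hL))) => (1 : Matrix ι ι ℝ)) (awC * ((L ^ i.kk : ℕ) : ℝ) ^ (d + 1)))) (fun y y' => P0 * (c35 * (L : ℝ) ^ i.m * α₀) * Real.exp (-(δF * (unitTorusGeo L i.kk (cvM d L i.m i.kk hL)).dist y y'))) ∧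
          HasMaj (BlockNorm.ofBlocks (unitTorusGeo L i.kk (cvM d L i.m i.kk hL)) (liftBlk (blockOf (L ^ i.r * L ^ i.kk) (cvM d L i.m i.kk hL)) ι)) (BlockNorm.ofBlocks (unitTorusGeo L i.kk (cvM d L i.m i.kk hL)) (liftBlk (fun b : Tor (fine (L ^ i.r * L ^ i.kk) (cvM d L i.m i.kk hL)) × Fin (d + 1) => blockOf (L ^ i.r * L ^ i.kk) (cvM d L i.m i.kk hL) b.1) ι)) (Matrix.mulVecLin (cgrad (cvM d L i.m i.kk hL) (L ^ i.r * L ^ i.kk) (cvT₀ e (fun μ x' => NormedSpace.exp (((((L ^ i.r * L ^ i.kk : ℕ) : ℝ))⁻¹) • A' μ x'))) * cGreen (cvM d L i.m i.kk hL) (L ^ i.r * L ^ i.kk) (cvT₀ e (fun μ x' => NormedSpace.exp (((((L ^ i.r * L ^ i.kk : ℕ) : ℝ))⁻¹) • A' μ x'))) (awF * ((L ^ i.r * L ^ i.kk : ℕ) : ℝ) ^ (d + 1)) - cgrad (cvM d L i.m i.kk hL) (L ^ i.r * L ^ i.kk) (fun (_ : Fin (d + 1)) (_ : Tor (fine (L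 ^ i.r * L ^ i.kk) (cvM d L i.m i.kk hL))) => (1 : Matrix ι ι ℝ)) * cGreen (cvM d L i.m i.kk hL) (L ^ i.r * L ^ i.kk) (fun (_ : Fin (d + 1)) (_ : Tor (fine (L ^ i.r * L ^ i.kk) (cvM d L i.m i.kk hL))) => (1 : Matrix ι ι ℝ)) (awF * ((L ^ i.r * L ^ i.kk : ℕ) : ℝ) ^ (d + 1)))) (fun y y' => P0 * (c35 * (L : ℝ) ^ i.m * α₀) * Real.exp (-(δF * (unitTorusGeo L i.kk (cvM d L i.m i.kk hL)).dist y y')))) := by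
  have hL2 : 2 ≤ L := le_trans (by norm_num) hL7
  have hL1r : (1 : ℝ) < (L : ℝ) := by exact_mod_cast hL.2
  have hLr : (0 : ℝ) < (L : ℝ) := by linarith
  obtain ⟨C, δK, hC, hδK, HK⟩ := flatKernelRows_king (d := d) L hL.1 hL2 (a₀ := (1 : ℝ)) one_pos
  obtain ⟨δ₂, CS, P0, aP, hδ₂, hCS, hP0, haP, hS⟩ := hS
  refine ⟨min δK δ₂, C, C, C, CS, P0, aP, lt_min hδK hδ₂, hC.le, hC.le, hC.le, hCS, hP0, haP, fun i => ?_⟩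
  have hK1 : 1 ≤ i.kk := i.one_le
  have hK2 : 1 ≤ i.r + i.kk := hK1.trans (Nat.le_add_left _ _)
  have hMc : ∀ μ, cvM d L i.m i.kk hL μ = 2 * L ^ (i.m + 1) := fun μ => rfl
  have hd0 := unitTorusGeo_dist_nonneg L i.kk (cvM d L i.m i.kk hL)
  obtain ⟨hG1c, hD1c, hA1c⟩ := HK i.kk hK1 (L ^ i.kk) rfl (i.m + 1) (cvM d L i.m i.kk hL) hMc i.kk ι
  obtain ⟨hG1f, hD1f, hA1f⟩ := HK (i.r + i.kk) hK2 (L ^ i.r * L ^ i.kk) (pow_add L i.r i.kk).symm (i.m + 1) (cvM d L i.m i.kk hL) hMc i.kk ι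
  obtain ⟨hSc, hSf, hP⟩ := hS i
  have hNc : (0 : ℝ) ≤ CS * ((L ^ i.kk : ℕ) : ℝ) ^ (d + 1) := by positivity
  have hNf : (0 : ℝ) ≤ CS * ((L ^ i.r * L ^ i.kk : ℕ) : ℝ) ^ (d + 1) := by positivity
  refine ⟨aK 1 (L : ℝ) i.kk, aK 1 (L : ℝ) (i.r + i.kk), aK_pos one_pos hL1r hK1, aK_le one_pos hL1r hK1, aK_pos one_pos hL1r hK2, aK_le one_pos hL1r hK2,
    ⟨hG1c.of_rate_le hd0 hC.le (min_le_left _ _), hA1c.of_rate_le hd0 hC.le (min_le_left _ _), hD1c.of_rate_le hd0 hC.le (min_le_left _ _), hSc.of_rate_le hd0 hNc (min_le_right _ _)⟩,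
    ⟨hG1f.of_rate_le hd0 hC.le (min_le_left _ _), hA1f.of_rate_le hd0 hC.le (min_le_left _ _), hD1f.of_rate_le hd0 hC.le (min_le_left _ _), hSf.of_rate_le hd0 hNf (min_le_right _ _)⟩,
    fun α₀ hα₀ hMa A' hA' => ?_⟩
  obtain ⟨hPc, hPf⟩ := hP α₀ hα₀ hMa A' hA'
  have hr0 : 0 ≤ P0 * (c35 * (L : ℝ) ^ i.m * α₀) := by positivity
  exact ⟨hPc.of_rate_le hd0 hr0 (min_le_right _ _), hPf.of_rate_le hd0 hr0 (min_le_right _ _)⟩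

omit [Nonempty mm] in
/-- ★★ **n15-c∕221's DISPLAY `hS` FROM n15-c∕223's DISPLAY `hP`** (the covariant gradient-difference rows alone): the `S⁻¹` row `(Q′G′²Q′ᵀ)⁻¹(1) ≤ C_S n^{d+1} e^{−δd}` is n15-c∕222b
`flatSopRow_ct_uniform` (the T⁴ cell's Combes–Thomas kit, uniform for `a′ ∈ [1∕2, 1]` ∋ King's masses) on both grids — n15-c∕223 `ne2PlusOperator_sfqr_of_gradDiffRow`'s proof text minus its
last line, NAMED.  MODEL; the gradient-difference rows stay HYPOTHESES. [cite: Balaban1984PropagatorsII, Prop. 2.3 p.231 (shape); King1986, Thm 3.3 p.656] -/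
theorem sopRow_of_gradDiffRow (hL : Odd L ∧ 1 < L) (hL7 : 7 ≤ L) {c35 : ℝ} (hc35 : 0 < c35)
    (hP : ∃ δ₂ P0 aP : ℝ, 0 < δ₂ ∧ 0 ≤ P0 ∧ 0 < aP ∧ ∀ i : SfIdx d L,
        ∀ α₀ : ℝ, 0 < α₀ → (L : ℝ) ^ i.m * α₀ ≤ aP → ∀ A' : Fin (d + 1) → CvX' d L i.m i.kk i.r hL → Matrix mm mm ℂ, (sfInstance d mm ι hL i).Bf.Reg335 c35 α₀ A' →
          HasMaj (BlockNorm.ofBlocks (unitTorusGeo L i.kk (cvM d L i.m i.kk hL)) (liftBlk (blockOf (L ^ i.kk) (cvM d L i.m i.kk hL)) ι)) (BlockNorm.ofBlocks (unitTorusGeo L i.kk (cvM d L i.m i.kk hL)) (liftBlk (fun b : Tor (fine (L ^ i.kk) (cvM d L i.m i.kk hL)) × Fin (d + 1) => blockOf (L ^ i.kk) (cvM d L i.m i.kk hL) b.1) ι)) (Matrix.mulVecLin (cgrad (cvM d L i.m i.kk hL) (L ^ i.kk) (cvT₀ e (fun μ x => NormedSpace.exp (((((L ^ i.kk : ℕ)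 : ℝ))⁻¹) • gavgM (Matrix mm mm ℂ) (Fin (d + 1)) (kingPrV L i.kk i.r (cvM d L i.m i.kk hL)) A' μ x))) * cGreen (cvM d L i.m i.kk hL) (L ^ i.kk) (cvT₀ e (fun μ x => NormedSpace.exp (((((L ^ i.kk : ℕ) : ℝ))⁻¹) • gavgM (Matrix mm mm ℂ) (Fin (d + 1)) (kingPrV L i.kk i.r (cvM d L i.m i.kk hL)) A' μ x))) (aK 1 (L : ℝ) i.kk * ((L ^ i.kk : ℕ) : ℝ) ^ (d + 1)) - cgrad (cvM d L i.m i.kk hL) (L ^ i.kk) (fun (_ : Fin (d + 1)) (_ : Tor (fine (L ^ i.kk) (cvM d L i.m i.kk hL))) => (1 : Matrix ι ι ℝ)) * cGreen (cvM d L i.m i.kk hL) (L ^ i.kk) (fun (_ : Fin (d + 1)) (_ : Tor (fine (L ^ i.kk) (cvM d L i.m i.kk hL))) => (1 : Matrix ι ι ℝ)) (aK 1 (L : ℝ) i.kk * ((L ^ i.kk : ℕ) : ℝ) ^ (d + 1)))) (fun y y' => P0 * (c35 * (L : ℝ) ^ i.m * α₀) * Real.exp (-(δ₂ * (unitTorusGeo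 L i.kk (cvM d L i.m i.kk hL)).dist y y'))) ∧
          HasMaj (BlockNorm.ofBlocks (unitTorusGeo L i.kk (cvM d L i.m i.kk hL)) (liftBlk (blockOf (L ^ i.r * L ^ i.kk) (cvM d L i.m i.kk hL)) ι)) (BlockNorm.ofBlocks (unitTorusGeo L i.kk (cvM d L i.m i.kk hL)) (liftBlk (fun b : Tor (fine (L ^ i.r * L ^ i.kk) (cvM d L i.m i.kk hL)) × Fin (d + 1) => blockOf (L ^ i.r * L ^ i.kk) (cvM d L i.m i.kk hL) b.1) ι)) (Matrix.mulVecLin (cgrad (cvM d L i.m i.kk hL) (L ^ i.r * L ^ i.kk) (cvT₀ e (fun μ x' => NormedSpace.exp (((((L ^ i.r * L ^ i.kk : ℕ) : ℝ))⁻¹) • A' μ x'))) * cGreen (cvM d L i.m i.kk hL) (L ^ i.r * L ^ i.kk) (cvT₀ e (fun μ x' => NormedSpace.exp (((((L ^ i.r * L ^ i.kk : ℕ) : ℝ))⁻¹) • A' μ x'))) (aK 1 (L : ℝ) (i.r + i.kk) * ((L ^ i.r * L ^ i.kk : ℕ) : ℝ) ^ (d + 1)) - cgrad (cvM d L i.m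 i.kk hL) (L ^ i.r * L ^ i.kk) (fun (_ : Fin (d + 1)) (_ : Tor (fine (L ^ i.r * L ^ i.kk) (cvM d L i.m i.kk hL))) => (1 : Matrix ι ι ℝ)) * cGreen (cvM d L i.m i.kk hL) (L ^ i.r * L ^ i.kk) (fun (_ : Fin (d + 1)) (_ : Tor (fine (L ^ i.r * L ^ i.kk) (cvM d L i.m i.kk hL))) => (1 : Matrix ι ι ℝ)) (aK 1 (L : ℝ) (i.r + i.kk) * ((L ^ i.r * L ^ i.kk : ℕ) : ℝ) ^ (d + 1)))) (fun y y' => P0 * (c35 * (L : ℝ) ^ i.m * α₀) * Real.exp (-(δ₂ * (unitTorusGeo L i.kk (cvM d L i.m i.kk hL)).dist y y')))) :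
    ∃ δ₂ CS P0 aP : ℝ, 0 < δ₂ ∧ 0 ≤ CS ∧ 0 ≤ P0 ∧ 0 < aP ∧ ∀ i : SfIdx d L,
        HasMaj (BlockNorm.ofBlocks (unitTorusGeo L i.kk (cvM d L i.m i.kk hL)) (liftBlk (fun y : Tor (cvM d L i.m i.kk hL) => y) ι)) (BlockNorm.ofBlocks (unitTorusGeo L i.kk (cvM d L i.m i.kk hL)) (liftBlk (fun y : Tor (cvM d L i.m i.kk hL) => y) ι)) (Matrix.mulVecLin (cSop (cvM d L i.m i.kk hL) (L ^ i.kk) (fun (_ : Fin (d + 1)) (_ : Tor (fine (L ^ i.kk) (cvM d L i.m i.kk hL))) => (1 : Matrix ι ι ℝ)) (aK 1 (L : ℝ) i.kk * ((L ^ i.kk : ℕ) : ℝ) ^ (d + 1)))⁻¹) (fun y y' => CS * ((L ^ i.kk : ℕ) : ℝ) ^ (d + 1) * Real.exp (-(δ₂ * (unitTorusGeo L i.kk (cvM d L i.m i.kk hL)).dist y y'))) ∧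
        HasMaj (BlockNorm.ofBlocks (unitTorusGeo L i.kk (cvM d L i.m i.kk hL)) (liftBlk (fun y : Tor (cvM d L i.m i.kk hL) => y) ι)) (BlockNorm.ofBlocks (unitTorusGeo L i.kk (cvM d L i.m i.kk hL)) (liftBlk (fun y : Tor (cvM d L i.m i.kk hL) => y) ι)) (Matrix.mulVecLin (cSop (cvM d L i.m i.kk hL) (L ^ i.r * L ^ i.kk) (fun (_ : Fin (d + 1)) (_ : Tor (fine (L ^ i.r * L ^ i.kk) (cvM d L i.m i.kk hL))) => (1 : Matrix ι ι ℝ)) (aK 1 (L : ℝ) (i.r + i.kk) * ((L ^ i.r * L ^ i.kk : ℕ) : ℝ) ^ (d + 1)))⁻¹) (fun y y' => CS * ((L ^ i.r * L ^ i.kk : ℕ) : ℝ) ^ (d + 1) * Real.exp (-(δ₂ * (unitTorusGeo L i.kk (cvM d L i.m i.kk hL)).dist y y'))) ∧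
        (∀ α₀ : ℝ, 0 < α₀ → (L : ℝ) ^ i.m * α₀ ≤ aP → ∀ A' : Fin (d + 1) → CvX' d L i.m i.kk i.r hL → Matrix mm mm ℂ, (sfInstance d mm ι hL i).Bf.Reg335 c35 α₀ A' →
          HasMaj (BlockNorm.ofBlocks (unitTorusGeo L i.kk (cvM d L i.m i.kk hL)) (liftBlk (blockOf (L ^ i.kk) (cvM d L i.m i.kk hL)) ι)) (BlockNorm.ofBlocks (unitTorusGeo L i.kk (cvM d L i.m i.kk hL)) (liftBlk (fun b : Tor (fine (L ^ i.kk) (cvM d L i.m i.kk hL)) × Fin (d + 1) => blockOf (L ^ i.kk) (cvM d L i.m i.kk hL) b.1) ι)) (Matrix.mulVecLin (cgrad (cvM d L i.m i.kk hL) (L ^ i.kk) (cvT₀ e (fun μ x => NormedSpace.exp (((((L ^ i.kk : ℕ) : ℝ))⁻¹) • gavgM (Matrix mm mm ℂ) (Fin (d + 1)) (kingPrV L i.kk i.r (cvM d L i.m i.kk hL)) A' μ x))) * cGreen (cvM d L i.m i.kk hL) (L ^ i.kk) (cvT₀ e (fun μ x => NormedSpace.exp (((((L ^ i.kk : ℕ)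 : ℝ))⁻¹) • gavgM (Matrix mm mm ℂ) (Fin (d + 1)) (kingPrV L i.kk i.r (cvM d L i.m i.kk hL)) A' μ x))) (aK 1 (L : ℝ) i.kk * ((L ^ i.kk : ℕ) : ℝ) ^ (d + 1)) - cgrad (cvM d L i.m i.kk hL) (L ^ i.kk) (fun (_ : Fin (d + 1)) (_ : Tor (fine (L ^ i.kk) (cvM d L i.m i.kk hL))) => (1 : Matrix ι ι ℝ)) * cGreen (cvM d L i.m i.kk hL) (L ^ i.kk) (fun (_ : Fin (d + 1)) (_ : Tor (fine (L ^ i.kk) (cvM d L i.m i.kk hL))) => (1 : Matrix ι ι ℝ)) (aK 1 (L : ℝ) i.kk * ((L ^ i.kk : ℕ) : ℝ) ^ (d + 1)))) (fun y y' => P0 * (c35 * (L : ℝ) ^ i.m * α₀) * Real.exp (-(δ₂ * (unitTorusGeo L i.kk (cvM d L i.m i.kk hL)).dist y y'))) ∧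
          HasMaj (BlockNorm.ofBlocks (unitTorusGeo L i.kk (cvM d L i.m i.kk hL)) (liftBlk (blockOf (L ^ i.r * L ^ i.kk) (cvM d L i.m i.kk hL)) ι)) (BlockNorm.ofBlocks (unitTorusGeo L i.kk (cvM d L i.m i.kk hL)) (liftBlk (fun b : Tor (fine (L ^ i.r * L ^ i.kk) (cvM d L i.m i.kk hL)) × Fin (d + 1) => blockOf (L ^ i.r * L ^ i.kk) (cvM d L i.m i.kk hL) b.1) ι)) (Matrix.mulVecLin (cgrad (cvM d L i.m i.kk hL) (L ^ i.r * L ^ i.kk) (cvT₀ e (fun μ x' => NormedSpace.exp (((((L ^ i.r * L ^ i.kk : ℕ) : ℝ))⁻¹) • A' μ x'))) * cGreen (cvM d L i.m i.kk hL) (L ^ i.r * L ^ i.kk) (cvT₀ e (fun μ x' => NormedSpace.exp (((((L ^ i.r * L ^ i.kk : ℕ) : ℝ))⁻¹) • A' μ x'))) (aK 1 (L : ℝ) (i.r + i.kk) * ((L ^ i.r * L ^ i.kk : ℕ) : ℝ) ^ (d + 1)) - cgrad (cvM d L i.m i.kk hL) (L ^ i.r * L ^ i.kk) (fun (_ : Fin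 (d + 1)) (_ : Tor (fine (L ^ i.r * L ^ i.kk) (cvM d L i.m i.kk hL))) => (1 : Matrix ι ι ℝ)) * cGreen (cvM d L i.m i.kk hL) (L ^ i.r * L ^ i.kk) (fun (_ : Fin (d + 1)) (_ : Tor (fine (L ^ i.r * L ^ i.kk) (cvM d L i.m i.kk hL))) => (1 : Matrix ι ι ℝ)) (aK 1 (L : ℝ) (i.r + i.kk) * ((L ^ i.r * L ^ i.kk : ℕ) : ℝ) ^ (d + 1)))) (fun y y' => P0 * (c35 * (L : ℝ) ^ i.m * α₀) * Real.exp (-(δ₂ * (unitTorusGeo L i.kk (cvM d L i.m i.kk hL)).dist y y')))) := by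
  have hL2 : 2 ≤ L := le_trans (by norm_num) hL7
  have hL1r : (1 : ℝ) < (L : ℝ) := by exact_mod_cast hL.2
  have hLr : (0 : ℝ) < (L : ℝ) := by linarith
  have hL2r : (2 : ℝ) ≤ (L : ℝ) := by exact_mod_cast hL2
  obtain ⟨CS, δS, hCS, hδS, HS⟩ := flatSopRow_ct_uniform (d := d) L (a₁ := (1 / 2 : ℝ)) (a₂ := (1 : ℝ)) (by norm_num) (by norm_num)
  obtain ⟨δ₂, P0, aP, hδ₂, hP0, haP, hP⟩ := hP
  -- King's masses lie in `[1/2, 1]`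
  have haKlo : ∀ K : ℕ, 1 ≤ K → (1 / 2 : ℝ) ≤ aK 1 (L : ℝ) K := fun K hK => by
    have h1 := aK_ge one_pos hL1r hK (a := (1 : ℝ))
    have hL4 : (4 : ℝ) ≤ (L : ℝ) ^ 2 := by nlinarith
    have hinv : ((L : ℝ) ^ 2)⁻¹ ≤ 1 / 4 := by rw [one_div]; exact inv_anti₀ (by norm_num) hL4
    linarith
  refine ⟨min δS δ₂, CS, P0, aP, lt_min hδS hδ₂, hCS.le, hP0, haP, fun i => ?_⟩
  have hK1 : 1 ≤ i.kk := i.one_le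
  have hK2 : 1 ≤ i.r + i.kk := hK1.trans (Nat.le_add_left _ _)
  have hd0 := unitTorusGeo_dist_nonneg L i.kk (cvM d L i.m i.kk hL)
  have hSc := HS (aK 1 (L : ℝ) i.kk) (haKlo i.kk hK1) (aK_le one_pos hL1r hK1) (cvM d L i.m i.kk hL) (L ^ i.kk) i.kk ι
  have hSf := HS (aK 1 (L : ℝ) (i.r + i.kk)) (haKlo (i.r + i.kk) hK2) (aK_le one_pos hL1r hK2) (cvM d L i.m i.kk hL) (L ^ i.r * L ^ i.kk) i.kk ι
  have hNc : (0 : ℝ) ≤ CS * ((L ^ i.kk : ℕ) : ℝ) ^ (d + 1) := by positivity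
  have hNf : (0 : ℝ) ≤ CS * ((L ^ i.r * L ^ i.kk : ℕ) : ℝ) ^ (d + 1) := by positivity
  refine ⟨hSc.of_rate_le hd0 hNc (min_le_left _ _), hSf.of_rate_le hd0 hNf (min_le_left _ _), fun α₀ hα₀ hMa A' hA' => ?_⟩
  obtain ⟨hPc, hPf⟩ := hP i α₀ hα₀ hMa A' hA'
  have hr0 : 0 ≤ P0 * (c35 * (L : ℝ) ^ i.m * α₀) := by positivity
  exact ⟨hPc.of_rate_le hd0 hr0 (min_le_right _ _), hPf.of_rate_le hd0 hr0 (min_le_right _ _)⟩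

/-- ★★ **207b's THREE THRESHOLDED GLOBAL LANDAU ROWS FROM n15-c∕221's DISPLAY** (`hS` = `S⁻¹` rows + gradient-difference rows; `hD` = the two-grid defect row): (♭-1)
`landauRows_small_of_flatRows_mass` ∘ `flatRowsMass_of_sopRow`.  MODEL; displayed rows are HYPOTHESES. [cite: Balaban1985BackgroundPropagators, (3.49) p.399, Thm 3.4 p.400 (shape)] -/
theorem landauRows_small_of_sopRow (hL : Odd L ∧ 1 < L) (hL7 : 7 ≤ L) {a : ℝ} (ha : 0 < a) {c35 : ℝ} (hc35 : 0 < c35)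
    (hS : ∃ δ₂ CS P0 aP : ℝ, 0 < δ₂ ∧ 0 ≤ CS ∧ 0 ≤ P0 ∧ 0 < aP ∧ ∀ i : SfIdx d L,
        HasMaj (BlockNorm.ofBlocks (unitTorusGeo L i.kk (cvM d L i.m i.kk hL)) (liftBlk (fun y : Tor (cvM d L i.m i.kk hL) => y) ι)) (BlockNorm.ofBlocks (unitTorusGeo L i.kk (cvM d L i.m i.kk hL)) (liftBlk (fun y : Tor (cvM d L i.m i.kk hL) => y) ι)) (Matrix.mulVecLin (cSop (cvM d L i.m i.kk hL) (L ^ i.kk) (fun (_ : Fin (d + 1)) (_ : Tor (fine (L ^ i.kk) (cvM d L i.m i.kk hL))) => (1 : Matrix ι ι ℝ)) (aK 1 (L : ℝ) i.kk * ((L ^ i.kk : ℕ) : ℝ) ^ (d + 1)))⁻¹) (fun y y' => CS * ((L ^ i.kk : ℕ) : ℝ) ^ (d + 1) * Real.exp (-(δ₂ * (unitTorusGeo L i.kk (cvM d L i.m i.kk hL)).dist y y'))) ∧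
        HasMaj (BlockNorm.ofBlocks (unitTorusGeo L i.kk (cvM d L i.m i.kk hL)) (liftBlk (fun y : Tor (cvM d L i.m i.kk hL) => y) ι)) (BlockNorm.ofBlocks (unitTorusGeo L i.kk (cvM d L i.m i.kk hL)) (liftBlk (fun y : Tor (cvM d L i.m i.kk hL) => y) ι)) (Matrix.mulVecLin (cSop (cvM d L i.m i.kk hL) (L ^ i.r * L ^ i.kk) (fun (_ : Fin (d + 1)) (_ : Tor (fine (L ^ i.r * L ^ i.kk) (cvM d L i.m i.kk hL))) => (1 : Matrix ι ι ℝ)) (aK 1 (L : ℝ) (i.r + i.kk) * ((L ^ i.r * L ^ i.kk : ℕ) : ℝ) ^ (d + 1)))⁻¹) (fun y y' => CS * ((L ^ i.r * L ^ i.kk : ℕ) : ℝ) ^ (d + 1) * Real.exp (-(δ₂ * (unitTorusGeo L i.kk (cvM d L i.m i.kk hL)).dist y y'))) ∧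
        (∀ α₀ : ℝ, 0 < α₀ → (L : ℝ) ^ i.m * α₀ ≤ aP → ∀ A' : Fin (d + 1) → CvX' d L i.m i.kk i.r hL → Matrix mm mm ℂ, (sfInstance d mm ι hL i).Bf.Reg335 c35 α₀ A' →
          HasMaj (BlockNorm.ofBlocks (unitTorusGeo L i.kk (cvM d L i.m i.kk hL)) (liftBlk (blockOf (L ^ i.kk) (cvM d L i.m i.kk hL)) ι)) (BlockNorm.ofBlocks (unitTorusGeo L i.kk (cvM d L i.m i.kk hL)) (liftBlk (fun b : Tor (fine (L ^ i.kk) (cvM d L i.m i.kk hL)) × Fin (d + 1) => blockOf (L ^ i.kk) (cvM d L i.m i.kk hL) b.1) ι)) (Matrix.mulVecLin (cgrad (cvM d L i.m i.kk hL) (L ^ i.kk) (cvT₀ e (fun μ x => NormedSpace.exp (((((L ^ i.kk : ℕ) : ℝ))⁻¹) • gavgM (Matrix mm mm ℂ) (Fin (d + 1)) (kingPrV L i.kk i.r (cvM d L i.m i.kk hL)) A' μ x))) * cGreen (cvM d L i.m i.kk hL) (L ^ i.kk) (cvT₀ e (fun μ x => NormedSpace.exp (((((L ^ i.kk : ℕ)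 : ℝ))⁻¹) • gavgM (Matrix mm mm ℂ) (Fin (d + 1)) (kingPrV L i.kk i.r (cvM d L i.m i.kk hL)) A' μ x))) (aK 1 (L : ℝ) i.kk * ((L ^ i.kk : ℕ) : ℝ) ^ (d + 1)) - cgrad (cvM d L i.m i.kk hL) (L ^ i.kk) (fun (_ : Fin (d + 1)) (_ : Tor (fine (L ^ i.kk) (cvM d L i.m i.kk hL))) => (1 : Matrix ι ι ℝ)) * cGreen (cvM d L i.m i.kk hL) (L ^ i.kk) (fun (_ : Fin (d + 1)) (_ : Tor (fine (L ^ i.kk) (cvM d L i.m i.kk hL))) => (1 : Matrix ι ι ℝ)) (aK 1 (L : ℝ) i.kk * ((L ^ i.kk : ℕ) : ℝ) ^ (d + 1)))) (fun y y' => P0 * (c35 * (L : ℝ) ^ i.m * α₀) * Real.exp (-(δ₂ * (unitTorusGeo L i.kk (cvM d L i.m i.kk hL)).dist y y'))) ∧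
          HasMaj (BlockNorm.ofBlocks (unitTorusGeo L i.kk (cvM d L i.m i.kk hL)) (liftBlk (blockOf (L ^ i.r * L ^ i.kk) (cvM d L i.m i.kk hL)) ι)) (BlockNorm.ofBlocks (unitTorusGeo L i.kk (cvM d L i.m i.kk hL)) (liftBlk (fun b : Tor (fine (L ^ i.r * L ^ i.kk) (cvM d L i.m i.kk hL)) × Fin (d + 1) => blockOf (L ^ i.r * L ^ i.kk) (cvM d L i.m i.kk hL) b.1) ι)) (Matrix.mulVecLin (cgrad (cvM d L i.m i.kk hL) (L ^ i.r * L ^ i.kk) (cvT₀ e (fun μ x' => NormedSpace.exp (((((L ^ i.r * L ^ i.kk : ℕ) : ℝ))⁻¹) • A' μ x'))) * cGreen (cvM d L i.m i.kk hL) (L ^ i.r * L ^ i.kk) (cvT₀ e (fun μ x' => NormedSpace.exp (((((L ^ i.r * L ^ i.kk : ℕ) : ℝ))⁻¹) • A' μ x'))) (aK 1 (L : ℝ) (i.r + i.kk) * ((L ^ i.r * L ^ i.kk : ℕ) : ℝ) ^ (d + 1)) - cgrad (cvM d L i.m i.kk hL) (L ^ i.r * L ^ i.kk) (fun (_ : Fin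 (d + 1)) (_ : Tor (fine (L ^ i.r * L ^ i.kk) (cvM d L i.m i.kk hL))) => (1 : Matrix ι ι ℝ)) * cGreen (cvM d L i.m i.kk hL) (L ^ i.r * L ^ i.kk) (fun (_ : Fin (d + 1)) (_ : Tor (fine (L ^ i.r * L ^ i.kk) (cvM d L i.m i.kk hL))) => (1 : Matrix ι ι ℝ)) (aK 1 (L : ℝ) (i.r + i.kk) * ((L ^ i.r * L ^ i.kk : ℕ) : ℝ) ^ (d + 1)))) (fun y y' => P0 * (c35 * (L : ℝ) ^ i.m * α₀) * Real.exp (-(δ₂ * (unitTorusGeo L i.kk (cvM d L i.m i.kk hL)).dist y y')))))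
    (hD : ∃ δD CR γR aD : ℝ, 0 < δD ∧ 0 ≤ CR ∧ 0 < γR ∧ 0 < aD ∧
      ∀ i : SfIdx d L, ∀ α₀ : ℝ, 0 < α₀ → (L : ℝ) ^ i.m * α₀ ≤ aD → ∀ A' : Fin (d + 1) → CvX' d L i.m i.kk i.r hL → Matrix mm mm ℂ, (sfInstance d mm ι hL i).Bf.Reg335 c35 α₀ A' →
        HasMaj (CvNorm d L i.m i.kk hL ι) (BlockNorm.ofBlocks (unitTorusGeo L i.kk (cvM d L i.m i.kk hL)) (liftBlk (cvBlk d L i.m i.kk hL ∘ (kingPrV L i.kk i.r (cvM d L i.m i.kk hL))) ι)) (idef (pull (liftMap (kingPrV L i.kk i.r (cvM d L i.m i.kk hL)) ι)) (pull (liftMap (kingPrV L i.kk i.r (cvM d L i.m i.kk hL)) ι)) (cvNVr' d L i.m i.kk i.r hL a ι e (fun μ x' => NormedSpace.exp (((((L ^ i.r * L ^ i.kk : ℕ) : ℝ))⁻¹) • A' μ x'))) (cvNVr d L i.m i.kk hL a ι e (fun μ x => NormedSpace.exp (((((L ^ i.kk : ℕ) : ℝ))⁻¹) • gavgM (Matrix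 mm mm ℂ) (Fin (d + 1)) (kingPrV L i.kk i.r (cvM d L i.m i.kk hL)) A' μ x)))) (fun y y' => (CR * ((L : ℝ) ^ i.kk) ^ (-γR)) * Real.exp (-(δD * (unitTorusGeo L i.kk (cvM d L i.m i.kk hL)).dist y y')))) :
    ∃ δR cR CR γR aG : ℝ, 0 < δR ∧ 0 ≤ cR ∧ 0 ≤ CR ∧ 0 < γR ∧ 0 < aG ∧
      ∀ i : SfIdx d L, ∀ α₀ : ℝ, 0 < α₀ → (L : ℝ) ^ i.m * α₀ ≤ aG → ∀ A' : Fin (d + 1) → CvX' d L i.m i.kk i.r hL → Matrix mm mm ℂ, (sfInstance d mm ι hL i).Bf.Reg335 c35 α₀ A' →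
        HasMaj (CvNorm d L i.m i.kk hL ι) (CvNorm d L i.m i.kk hL ι) (cvNVr d L i.m i.kk hL a ι e (fun μ x => NormedSpace.exp (((((L ^ i.kk : ℕ) : ℝ))⁻¹) • gavgM (Matrix mm mm ℂ) (Fin (d + 1)) (kingPrV L i.kk i.r (cvM d L i.m i.kk hL)) A' μ x))) (fun y y' => (cR * (c35 * (L : ℝ) ^ i.m * α₀)) * Real.exp (-(δR * (unitTorusGeo L i.kk (cvM d L i.m i.kk hL)).dist y y'))) ∧
        HasMaj (BlockNorm.ofBlocks (unitTorusGeo L i.kk (cvM d L i.m i.kk hL)) (liftBlk (cvBlk d L i.m i.kk hL ∘ (kingPrV L i.kk i.r (cvM d L i.m i.kk hL))) ι)) (BlockNorm.ofBlocks (unitTorusGeo L i.kk (cvM d L i.m i.kk hL)) (liftBlk (cvBlk d L i.m i.kk hL ∘ (kingPrV L i.kk i.r (cvM d L i.m i.kk hL))) ι)) (cvNVr' d L i.m i.kk i.r hL a ι e (fun μ x' => NormedSpace.exp (((((L ^ i.r * L ^ i.kk : ℕ) : ℝ))⁻¹) • A' μ x'))) (fun y y' => (cR * (c35 * (L : ℝ)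 ^ i.m * α₀)) * Real.exp (-(δR * (unitTorusGeo L i.kk (cvM d L i.m i.kk hL)).dist y y'))) ∧
        HasMaj (CvNorm d L i.m i.kk hL ι) (BlockNorm.ofBlocks (unitTorusGeo L i.kk (cvM d L i.m i.kk hL)) (liftBlk (cvBlk d L i.m i.kk hL ∘ (kingPrV L i.kk i.r (cvM d L i.m i.kk hL))) ι)) (idef (pull (liftMap (kingPrV L i.kk i.r (cvM d L i.m i.kk hL)) ι)) (pull (liftMap (kingPrV L i.kk i.r (cvM d L i.m i.kk hL)) ι)) (cvNVr' d L i.m i.kk i.r hL a ι e (fun μ x' => NormedSpace.exp (((((L ^ i.r * L ^ i.kk : ℕ) : ℝ))⁻¹) • A' μ x'))) (cvNVr d L i.m i.kk hL a ι e (fun μ x => NormedSpace.exp (((((L ^ i.kk : ℕ) : ℝ))⁻¹) • gavgM (Matrix mm mm ℂ) (Fin (d + 1)) (kingPrV L i.kk i.r (cvM d L i.m i.kk hL)) A' μ x)))) (fun y y' => (CR * ((L : ℝ) ^ i.kk) ^ (-γR)) * Real.exp (-(δR * (unitTorusGeo L i.kk (cvM d L i.m i.kk hL)).dist y y'))) 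:=
  landauRows_small_of_flatRows_mass d mm ι e hL ha hc35 (flatRowsMass_of_sopRow d mm ι e hL hL7 hc35 hS) hD

/-- ★★★ **207b's THREE THRESHOLDED GLOBAL LANDAU ROWS FROM n15-c∕223's DISPLAY — ALL FOUR FLAT ROWS PROVED** (`hP` = per grid the ONE covariant gradient-difference row
`D_TG′(T) − ∂G′(1) ≤ P₀·r·e^{−δd}`, [B9] Thm 3.4's Schauder-type row; `hD` = the two-grid η-defect row of `N_V^R`): `landauRows_small_of_sopRow` ∘ `sopRow_of_gradDiffRow`.  The socket every
layer of the (P-R) one-propagator literal plugs into ((♭-3)); the sequel (♭-7) issues the three-layer edition.  MODEL; the two displayed rows are HYPOTHESES; NOT [B9] Thms 3.1–3.4 as printed.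
[cite: Balaban1985BackgroundPropagators, (3.49) p.399, Thm 3.4 p.400 (shape); Balaban1983RegularityDecay, Theorem (1.10) p.573; King1986, Thm 3.3 p.656] -/
theorem landauRows_small_of_gradDiffRow (hL : Odd L ∧ 1 < L) (hL7 : 7 ≤ L) {a : ℝ} (ha : 0 < a) {c35 : ℝ} (hc35 : 0 < c35)
    (hP : ∃ δ₂ P0 aP : ℝ, 0 < δ₂ ∧ 0 ≤ P0 ∧ 0 < aP ∧ ∀ i : SfIdx d L,
        ∀ α₀ : ℝ, 0 < α₀ → (L : ℝ) ^ i.m * α₀ ≤ aP → ∀ A' : Fin (d + 1) → CvX' d L i.m i.kk i.r hL → Matrix mm mm ℂ, (sfInstance d mm ι hL i).Bf.Reg335 c35 α₀ A' →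
          HasMaj (BlockNorm.ofBlocks (unitTorusGeo L i.kk (cvM d L i.m i.kk hL)) (liftBlk (blockOf (L ^ i.kk) (cvM d L i.m i.kk hL)) ι)) (BlockNorm.ofBlocks (unitTorusGeo L i.kk (cvM d L i.m i.kk hL)) (liftBlk (fun b : Tor (fine (L ^ i.kk) (cvM d L i.m i.kk hL)) × Fin (d + 1) => blockOf (L ^ i.kk) (cvM d L i.m i.kk hL) b.1) ι)) (Matrix.mulVecLin (cgrad (cvM d L i.m i.kk hL) (L ^ i.kk) (cvT₀ e (fun μ x => NormedSpace.exp (((((L ^ i.kk : ℕ) : ℝ))⁻¹) • gavgM (Matrix mm mm ℂ) (Fin (d + 1)) (kingPrV L i.kk i.r (cvM d L i.m i.kk hL)) A' μ x))) * cGreen (cvM d L i.m i.kk hL) (L ^ i.kk) (cvT₀ e (fun μ x => NormedSpace.exp (((((L ^ i.kk : ℕ) : ℝ))⁻¹) • gavgM (Matrix mm mm ℂ) (Fin (d + 1)) (kingPrV L i.kk i.r (cvM d L i.m i.kk hL)) A' μ x))) (aK 1 (L : ℝ) i.kk * ((L ^ i.kk : ℕ) : ℝ) ^ (d + 1)) -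 cgrad (cvM d L i.m i.kk hL) (L ^ i.kk) (fun (_ : Fin (d + 1)) (_ : Tor (fine (L ^ i.kk) (cvM d L i.m i.kk hL))) => (1 : Matrix ι ι ℝ)) * cGreen (cvM d L i.m i.kk hL) (L ^ i.kk) (fun (_ : Fin (d + 1)) (_ : Tor (fine (L ^ i.kk) (cvM d L i.m i.kk hL))) => (1 : Matrix ι ι ℝ)) (aK 1 (L : ℝ) i.kk * ((L ^ i.kk : ℕ) : ℝ) ^ (d + 1)))) (fun y y' => P0 * (c35 * (L : ℝ) ^ i.m * α₀) * Real.exp (-(δ₂ * (unitTorusGeo L i.kk (cvM d L i.m i.kk hL)).dist y y'))) ∧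
          HasMaj (BlockNorm.ofBlocks (unitTorusGeo L i.kk (cvM d L i.m i.kk hL)) (liftBlk (blockOf (L ^ i.r * L ^ i.kk) (cvM d L i.m i.kk hL)) ι)) (BlockNorm.ofBlocks (unitTorusGeo L i.kk (cvM d L i.m i.kk hL)) (liftBlk (fun b : Tor (fine (L ^ i.r * L ^ i.kk) (cvM d L i.m i.kk hL)) × Fin (d + 1) => blockOf (L ^ i.r * L ^ i.kk) (cvM d L i.m i.kk hL) b.1) ι)) (Matrix.mulVecLin (cgrad (cvM d L i.m i.kk hL) (L ^ i.r * L ^ i.kk) (cvT₀ e (fun μ x' => NormedSpace.exp (((((L ^ i.r * L ^ i.kk : ℕ) : ℝ))⁻¹) • A' μ x'))) * cGreen (cvM d L i.m i.kk hL) (L ^ i.r * L ^ i.kk) (cvT₀ e (fun μ x' => NormedSpace.exp (((((L ^ i.r * L ^ i.kk : ℕ) : ℝ))⁻¹) • A' μ x'))) (aK 1 (L : ℝ) (i.r + i.kk) * ((L ^ i.r * L ^ i.kk : ℕ) : ℝ) ^ (d + 1)) - cgrad (cvM d L i.m i.kk hL) (L ^ i.r * L ^ i.kk) (fun (_ : Fin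 (d + 1)) (_ : Tor (fine (L ^ i.r * L ^ i.kk) (cvM d L i.m i.kk hL))) => (1 : Matrix ι ι ℝ)) * cGreen (cvM d L i.m i.kk hL) (L ^ i.r * L ^ i.kk) (fun (_ : Fin (d + 1)) (_ : Tor (fine (L ^ i.r * L ^ i.kk) (cvM d L i.m i.kk hL))) => (1 : Matrix ι ι ℝ)) (aK 1 (L : ℝ) (i.r + i.kk) * ((L ^ i.r * L ^ i.kk : ℕ) : ℝ) ^ (d + 1)))) (fun y y' => P0 * (c35 * (L : ℝ) ^ i.m * α₀) * Real.exp (-(δ₂ * (unitTorusGeo L i.kk (cvM d L i.m i.kk hL)).dist y y'))))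
    (hD : ∃ δD CR γR aD : ℝ, 0 < δD ∧ 0 ≤ CR ∧ 0 < γR ∧ 0 < aD ∧
      ∀ i : SfIdx d L, ∀ α₀ : ℝ, 0 < α₀ → (L : ℝ) ^ i.m * α₀ ≤ aD → ∀ A' : Fin (d + 1) → CvX' d L i.m i.kk i.r hL → Matrix mm mm ℂ, (sfInstance d mm ι hL i).Bf.Reg335 c35 α₀ A' →
        HasMaj (CvNorm d L i.m i.kk hL ι) (BlockNorm.ofBlocks (unitTorusGeo L i.kk (cvM d L i.m i.kk hL)) (liftBlk (cvBlk d L i.m i.kk hL ∘ (kingPrV L i.kk i.r (cvM d L i.m i.kk hL))) ι)) (idef (pull (liftMap (kingPrV L i.kk i.r (cvM d L i.m i.kk hL)) ι)) (pull (liftMap (kingPrV L i.kk i.r (cvM d L i.m i.kk hL)) ι)) (cvNVr' d L i.m i.kk i.r hL a ι e (fun μ x' => NormedSpace.exp (((((L ^ i.r * L ^ i.kk : ℕ) : ℝ))⁻¹) • A' μ x'))) (cvNVr d L i.m i.kk hL a ι e (fun μ x => NormedSpace.exp (((((L ^ i.kk : ℕ) : ℝ))⁻¹) • gavgM (Matrix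 mm mm ℂ) (Fin (d + 1)) (kingPrV L i.kk i.r (cvM d L i.m i.kk hL)) A' μ x)))) (fun y y' => (CR * ((L : ℝ) ^ i.kk) ^ (-γR)) * Real.exp (-(δD * (unitTorusGeo L i.kk (cvM d L i.m i.kk hL)).dist y y')))) :
    ∃ δR cR CR γR aG : ℝ, 0 < δR ∧ 0 ≤ cR ∧ 0 ≤ CR ∧ 0 < γR ∧ 0 < aG ∧
      ∀ i : SfIdx d L, ∀ α₀ : ℝ, 0 < α₀ → (L : ℝ) ^ i.m * α₀ ≤ aG → ∀ A' : Fin (d + 1) → CvX' d L i.m i.kk i.r hL → Matrix mm mm ℂ, (sfInstance d mm ι hL i).Bf.Reg335 c35 α₀ A' →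
        HasMaj (CvNorm d L i.m i.kk hL ι) (CvNorm d L i.m i.kk hL ι) (cvNVr d L i.m i.kk hL a ι e (fun μ x => NormedSpace.exp (((((L ^ i.kk : ℕ) : ℝ))⁻¹) • gavgM (Matrix mm mm ℂ) (Fin (d + 1)) (kingPrV L i.kk i.r (cvM d L i.m i.kk hL)) A' μ x))) (fun y y' => (cR * (c35 * (L : ℝ) ^ i.m * α₀)) * Real.exp (-(δR * (unitTorusGeo L i.kk (cvM d L i.m i.kk hL)).dist y y'))) ∧
        HasMaj (BlockNorm.ofBlocks (unitTorusGeo L i.kk (cvM d L i.m i.kk hL)) (liftBlk (cvBlk d L i.m i.kk hL ∘ (kingPrV L i.kk i.r (cvM d L i.m i.kk hL))) ι)) (BlockNorm.ofBlocks (unitTorusGeo L i.kk (cvM d L i.m i.kk hL)) (liftBlk (cvBlk d L i.m i.kk hL ∘ (kingPrV L i.kk i.r (cvM d L i.m i.kk hL))) ι)) (cvNVr' d L i.m i.kk i.r hL a ι e (fun μ x' => NormedSpace.exp (((((L ^ i.r * L ^ i.kk : ℕ) : ℝ))⁻¹) • A' μ x'))) (fun y y' => (cR * (c35 * (L : ℝ)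 ^ i.m * α₀)) * Real.exp (-(δR * (unitTorusGeo L i.kk (cvM d L i.m i.kk hL)).dist y y'))) ∧
        HasMaj (CvNorm d L i.m i.kk hL ι) (BlockNorm.ofBlocks (unitTorusGeo L i.kk (cvM d L i.m i.kk hL)) (liftBlk (cvBlk d L i.m i.kk hL ∘ (kingPrV L i.kk i.r (cvM d L i.m i.kk hL))) ι)) (idef (pull (liftMap (kingPrV L i.kk i.r (cvM d L i.m i.kk hL)) ι)) (pull (liftMap (kingPrV L i.kk i.r (cvM d L i.m i.kk hL)) ι)) (cvNVr' d L i.m i.kk i.r hL a ι e (fun μ x' => NormedSpace.exp (((((L ^ i.r * L ^ i.kk : ℕ) : ℝ))⁻¹) • A' μ x'))) (cvNVr d L i.m i.kk hL a ι e (fun μ x => NormedSpace.exp (((((L ^ i.kk : ℕ) : ℝ))⁻¹) • gavgM (Matrix mm mm ℂ) (Fin (d + 1)) (kingPrV L i.kk i.r (cvM d L i.m i.kk hL)) A' μ x)))) (fun y y' => (CR * ((L : ℝ) ^ i.kk) ^ (-γR)) * Real.exp (-(δR * (unitTorusGeo L i.kk (cvM d L i.m i.kk hL)).dist y y'))) 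:=
  landauRows_small_of_sopRow d mm ι e hL hL7 ha hc35 (sopRow_of_gradDiffRow d mm ι e hL hL7 hc35 hP) hD

end Node

end Summit.QuantumFields.YangMills.BalabanUVNodes.N15.Gluing

end
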